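import Summits.PneNP.PneNP.Theorems.RegularResolutionRung.Negative.EmptyGraphLines
import Literature.Computability.MetaComplexity.ResolutionProofs
import Literature.Combinatorics.SimpleGraph.RamseyNumbers
import Summits.PneNP.PneNP.Theorems.RamseyUncertifiableResolutionUncertaintyCoreTransfer
import Summits.PneNP.PneNP.Theorems.RamseyUncertifiableResolutionUncertaintyRestrictRefutation
import Summits.PneNP.PneNP.Theorems.RamseyUncertifiableResolutionUncertaintyDRCStep
import Summits.PneNP.PneNP.Theorems.RamseyUncertifiableResolutionUncertaintyPromelRodl

/-!
# Line `box-dag-self-gadget-lifting` for crux `RamseyUncertifiable.ResolutionUncertainty` (stmt-PneNP-9816)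

LEAD SKELETON (prover-line-stmt-PneNP-9816-0, 2026-08-16), reshaped from the crux-plan skeleton
`Cruxes/ResolutionUncertainty/Lines/box-dag-self-gadget-lifting.lean` (planner-cruxplan-…-box-dag-self-gadget--0):

* every stub is stated INLINE over TREE VOCABULARY ONLY (Mathlib + `Literature` + the landed
  `Theorems/RegularResolutionRung/Negative/EmptyGraphLines.lean`, whose `cliqueCNF n k adj` IS the route's inlined
  `let cnf`), so that a helper file `Theorems/RamseyUncertifiableResolutionUncertainty<Stub>.lean`
  (`--supports stmt-PneNP-9816`) can copy the `open` lines below and the stub statement byte-for-byte;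
* the Prömel–Rödl core stub of the plan (`PromelRodlCore`, size L, source paywalled: acq-04048) is RESHAPED into two
  registered stubs with a self-contained proof plan that needs only Erdős–Szekeres (tree:
  `Literature.Combinatorics.SimpleGraph.exists_clique_or_indep_of_choose_le_card`) and finite dependent random choice:
  `stub_drcStep` (sparse pair + no `k`-clique ⇒ a `log₂ n/40`-size independent set with polynomially many common
  NON-neighbours) and `stub_promelRodl : DRCStep → PRCore` (the ≤ 161-level "bad pair ⇒ grow a homogeneous set"
  recursion; LPRT arXiv:1303.3166 Lemma 11 = Prömel–Rödl 1999 in disjoint-pair form, `|S| ≥ n^{3/4}`);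
* `stub_coreTransfer` (glue): Finset core ⇒ `Fin m`-indexed core via `orderEmbOfFin` — LANDED p74070;
* `stub_restrictRefutation` (ABdRLNR Fact 3.2 for this CNF) — LANDED p74232; `stub_drcStep` — LANDED p74269; `stub_promelRodl` —
  LANDED p74227; so the crux is KERNEL-REDUCED to `stub_biDenseCoreHardness` (THE LEVER, the only `sorry` left), stated over
  DISJOINT-pair bi-density (equivalent up to `(β, δ)` reparametrisation, and what PR gives). The lever's first lemma
  `heavyBlockWidth` (LPRT Lemma 13 in unary) is LANDED separately (p75709 `…Adversary.lean`, p75788 `…HeavyBlockWidth.lean`);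
  the lever itself is OPEN — see `Cruxes/ResolutionUncertainty/NOTES.md` (PARKING obstruction, promote-stub recommendation).

THE LINE (LPRT template "pseudo-random core + hardness on the core", one encoding up): soundness of resolution on
BOTH `π₁`, `π₂` (proved: `cliqueFree_of_refutation`) ⇒ `G` is 2-Ramsey ⇒ PR core `S`, `|S| ≥ n^{3/4}`, both `G[S]`,
`Ḡ[S]` `δ`-lower-dense between disjoint `|S|^{1-β}`-sets ⇒ restrict `π₁` to the core ⇒ LEVER ⇒
`n^{(9/16)ε log₂ n} ≤ m^{ε log₂ m} ≤ |π₁'| ≤ |π₁| ≤ max(|π₁|,|π₂|)`.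

Disproof used (cdisprove evidence notes 2026-08-15T22:26Z/22:38Z/22:47Z; `Disproof.lean` itself is not mounted in
this seat and `ledger crux cat … Disproof.lean` has no workfile): one-sided variants FALSE (`G = ⊥/⊤`) — honoured,
`π₂` is consumed through soundness (`Gᶜ.CliqueFree k`), without which the core stubs do not fire;
`exists_refutation_le_pow_cliqueNum` / `eps_le_half_of_with` (`ε ≤ 1/2`) — respected, all exponents existential and
the lever's `ε(β,δ) = O(β²)` (TRIAGE-r1-1 App. A); `not_allExponents'` — no ∀ε statement; `ramseyAbundant_holds` —
hypotheses non-vacuous. No `Theorems/ResolutionUncertainty/Negative/*` lemma exists to import.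
-/

set_option linter.unusedVariables false
set_option linter.dupNamespace false

namespace Summit.PneNP.PneNP.Cruxes.ResolutionUncertainty.BoxDagSelfGadgetLifting

open Literature.Computability.Complexity Literature.Computability.MetaComplexity
open Summit.PneNP.PneNP.Theorems.RegularResolutionRung.Negative (cliqueCNF)

/-! ## The crux, unfolded -/

/-- The crux with its `let`s unfolded through the tree's `cliqueCNF`. -/
def CruxUnfolded : Prop :=
  ∃ ε : ℝ, 0 < ε ∧ ∃ n₀ : ℕ, ∀ n ≥ n₀, ∀ (G : SimpleGraph (Fin n)) [DecidableRel G.Adj],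
    ∀ π₁ π₂ : List (ResLine ℕ),
      IsResRefutation (cliqueCNF n (Nat.clog 2 (n ^ 2)) fun u v => decide (G.Adj u v)) π₁ →
      IsResRefutation (cliqueCNF n (Nat.clog 2 (n ^ 2)) fun u v => decide (Gᶜ.Adj u v)) π₂ →
      (n : ℝ) ^ (ε * Real.logb 2 n) ≤ max (π₁.length : ℝ) (π₂.length : ℝ)

/-- The route's crux decl is definitionally `CruxUnfolded`. -/
theorem crux_unfold :
    Summit.PneNP.PneNP.Theses.RamseyUncertifiable.ResolutionUncertainty ↔ CruxUnfolded :=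
  Iff.rfl

/-! ## Vocabulary (abbreviations only — every stub below restates what it needs inline) -/

/-- DISJOINT-PAIR TWO-SIDED LOWER DENSITY at scale `scale`: between every two disjoint vertex sets of size `≥ scale`
both `H` and `Hᶜ` have (Mathlib, ordered-pair) edge density `≥ δ`. Prömel–Rödl / LPRT Lemma 11 "`δ ≤ d(A,B) ≤ 1-δ`"
in complement-symmetric form. -/
def BiDense {m : ℕ} (H : SimpleGraph (Fin m)) [DecidableRel H.Adj] (δ scale : ℝ) : Prop :=
  ∀ A B : Finset (Fin m), Disjoint A B → scale ≤ A.card → scale ≤ B.card →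
    δ ≤ (H.edgeDensity A B : ℝ) ∧ δ ≤ (Hᶜ.edgeDensity A B : ℝ)

/-- `RestrictRefutation` (ABdRLNR arXiv:2012.09476 Fact 3.2 / 2.1 for this CNF): restricting a refutation of
`Clique(adj, k)` on `n` vertices to the sub-table along `e : Fin m ↪ Fin n` does not lengthen it. -/
def RestrictRefutation : Prop :=
  ∀ (n m k : ℕ) (adj : Fin n → Fin n → Bool) (e : Fin m ↪ Fin n) (π : List (ResLine ℕ)),
    IsResRefutation (cliqueCNF n k adj) π →
    ∃ π' : List (ResLine ℕ),
      IsResRefutation (cliqueCNF m k fun a b => adj (e a) (e b)) π' ∧ π'.length ≤ π.length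

/-- `DRCStep` — dependent random choice + Erdős–Szekeres, one-sided (the engine of the Prömel–Rödl recursion):
for every `κ > 0` there are `δ > 0`, `n₀` such that in every graph `H` on `n ≥ n₀` vertices with no
`⌈log₂ n²⌉`-clique, whenever `A` (`|A| ≥ √n`) is pointwise `δ`-sparse towards `B`, some independent set `J ⊆ A` of
size `≥ log₂ n / 40` has at least `|B|·n^{-κ}` common NON-neighbours in `B`. -/
def DRCStep : Prop :=
  ∀ κ : ℝ, 0 < κ → ∃ δ : ℝ, 0 < δ ∧ ∃ n₀ : ℕ, ∀ n ≥ n₀, ∀ (H : SimpleGraph (Fin n)) [DecidableRel H.Adj],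
    H.CliqueFree (Nat.clog 2 (n ^ 2)) →
    ∀ A B : Finset (Fin n), (n : ℝ) ^ ((1 : ℝ) / 2) ≤ A.card →
      (∀ v ∈ A, ((B.filter fun b => H.Adj v b).card : ℝ) ≤ δ * B.card) →
      ∃ J ⊆ A, Hᶜ.IsClique (J : Set (Fin n)) ∧ Real.logb 2 n / 40 ≤ J.card ∧
        (B.card : ℝ) * (n : ℝ) ^ (-κ) ≤ ((B.filter fun b => ∀ v ∈ J, ¬ H.Adj v b).card : ℝ)

/-- `PRCore` — Prömel–Rödl 1999 / LPRT arXiv:1303.3166 Lemma 11 at `c = 2`, disjoint-pair form: every graph on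
`n ≥ n₀` vertices with neither a clique nor an independent set of size `⌈log₂ n²⌉` has a vertex set `S`,
`|S| ≥ n^{3/4}`, inside which `G` and `Gᶜ` are both `δ`-lower-dense between disjoint sets of size `≥ |S|^{1-β}`. -/
def PRCore : Prop :=
  ∃ β δ : ℝ, 0 < β ∧ β < 1 ∧ 0 < δ ∧ ∃ n₀ : ℕ, ∀ n ≥ n₀, ∀ (G : SimpleGraph (Fin n)) [DecidableRel G.Adj],
    G.CliqueFree (Nat.clog 2 (n ^ 2)) → Gᶜ.CliqueFree (Nat.clog 2 (n ^ 2)) →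
    ∃ S : Finset (Fin n), (n : ℝ) ^ ((3 : ℝ) / 4) ≤ S.card ∧
      ∀ A ⊆ S, ∀ B ⊆ S, Disjoint A B →
        (S.card : ℝ) ^ (1 - β) ≤ A.card → (S.card : ℝ) ^ (1 - β) ≤ B.card →
        δ ≤ (G.edgeDensity A B : ℝ) ∧ δ ≤ (Gᶜ.edgeDensity A B : ℝ)

/-- `CoreComap` — the same core re-indexed as a graph on `Fin m` (the form the restriction and the lever consume):
`m⁴ ≥ n³` and `BiDense (G.comap e) δ (m^{1-β})`. -/
def CoreComap : Prop :=
  ∃ β δ : ℝ, 0 < β ∧ β < 1 ∧ 0 < δ ∧ ∃ n₀ : ℕ, ∀ n : ℕ, n₀ ≤ n →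
    ∀ (G : SimpleGraph (Fin n)) [DecidableRel G.Adj],
      G.CliqueFree (Nat.clog 2 (n ^ 2)) → Gᶜ.CliqueFree (Nat.clog 2 (n ^ 2)) →
      ∃ (m : ℕ) (e : Fin m ↪ Fin n), n ^ 3 ≤ m ^ 4 ∧ BiDense (G.comap e) δ ((m : ℝ) ^ (1 - β))

/-- `BiDenseCoreHardness` — THE LEVER (conjectural; contains general dag-like resolution of `Clique(G(m,½), 2log₂m)`):
two-sided disjoint-pair lower density at scale `m^{1-β}` forces every resolution refutation of the unary
`Clique(H, k)`, `k ≤ 3 log₂ m`, to have length `≥ m^{ε log₂ m}`, `ε = ε(β, δ) > 0` (calibration: `ε ≤ 2β²`,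
`ε ≤ 1/2`). -/
def BiDenseCoreHardness : Prop :=
  ∀ β δ : ℝ, 0 < β → β < 1 → 0 < δ →
    ∃ ε : ℝ, 0 < ε ∧ ∃ m₀ : ℕ, ∀ m : ℕ, m₀ ≤ m → ∀ k : ℕ, (k : ℝ) ≤ 3 * Real.logb 2 m →
      ∀ (H : SimpleGraph (Fin m)) [DecidableRel H.Adj], BiDense H δ ((m : ℝ) ^ (1 - β)) →
        ∀ π : List (ResLine ℕ), IsResRefutation (cliqueCNF m k fun u v => decide (H.Adj u v)) π →
          (m : ℝ) ^ (ε * Real.logb 2 m) ≤ π.length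

/-! ## First lemma toward the lever — PROVED and LANDED
`Summit.PneNP.PneNP.Theorems.RamseyUncertifiableResolutionUncertainty.heavyBlockWidth` (p75709 `…Adversary.lean`, p75788
`…HeavyBlockWidth.lean`; heavy-block width = LPRT Lemma 13 in UNARY, with the necessary extra hypothesis `δ ≤ 1` that the crux-plan's
typed version lacked): one-sided `δ`-density at scale `M` with room `(k + 2^t + 2)·M ≤ δ^t·m/2` forces a clause with `≥ t` heavy
blocks in every refutation of `Clique(H, k)`. NOT a registered stub (not on the kernel path to the crux: a size bound needs
`log(m/M)` bits per heavy block — see `Cruxes/ResolutionUncertainty/NOTES.md`). Not imported here only because the farm snapshot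
serving `lean check` lags one module behind the tree at the time of writing. -/

/-! ## Sub-target for the promoted lever (typed; see `Cruxes/ResolutionUncertainty/NOTES.md` = work/LEVER.md §3) -/

/-- A derivation is PIN-MONOTONE if no backward step into a NON-initial premise drops a negative literal ("pin"): for a
resolution line with premises `i` (containing the positive pivot) and `j` (containing the negative pivot), every negative
literal of the conclusion lies in premise `i` unless premise `i` is an initial clause, and every negative literal of the
conclusion other than the negative pivot lies in premise `j` unless premise `j` is initial; likewise for weakenings. Brute-force
refutations of `cliqueCNF` (pin a vertex per block, recurse into the common neighbourhood) are pin-monotone; PARKING (LEVER.md §2ζ)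
is exactly what pin-monotonicity forbids. -/
def IsPinMonotone (π : List (ResLine ℕ)) : Prop :=
  ∀ t (ht : t < π.length),
    match (π[t]'ht).rule with
    | .initial => True
    | .resolve i j v =>
        (∀ hi : i < π.length, (π[i]'hi).rule ≠ .initial →
          ∀ l ∈ (π[t]'ht).clause, l.2 = false → l ∈ (π[i]'hi).clause) ∧
        (∀ hj : j < π.length, (π[j]'hj).rule ≠ .initial →
          ∀ l ∈ (π[t]'ht).clause, l.2 = false → l ≠ (v, false) → l ∈ (π[j]'hj).clause)
    | .weaken i =>
        ∀ hi : i < π.length, (π[i]'hi).rule ≠ .initial →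
          ∀ l ∈ (π[t]'ht).clause, l.2 = false → l ∈ (π[i]'hi).clause

/-- **Sub-target for the promoted lever** (`PinMonotoneCoreHardness`, conjectural; weaker than the lever): the lever restricted to
pin-monotone refutations — between tree-like (known: LPRT Thm 4 machinery) and dag-like (the lever); it excludes PARKING but, as
`Cruxes/ResolutionUncertainty/NOTES.md` §3 cautions, not squeeze-hiding, so the cleanly attackable class is the smaller MONOTONE one
described there (pins AND in-fibre exclusions of unpinned blocks never dropped). -/
def PinMonotoneCoreHardness : Prop :=
  ∀ β δ : ℝ, 0 < β → β < 1 → 0 < δ →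
    ∃ ε : ℝ, 0 < ε ∧ ∃ m₀ : ℕ, ∀ m : ℕ, m₀ ≤ m → ∀ k : ℕ, (k : ℝ) ≤ 3 * Real.logb 2 m →
      ∀ (H : SimpleGraph (Fin m)) [DecidableRel H.Adj],
        (∀ A B : Finset (Fin m), Disjoint A B → (m : ℝ) ^ (1 - β) ≤ A.card → (m : ℝ) ^ (1 - β) ≤ B.card →
          δ ≤ (H.edgeDensity A B : ℝ) ∧ δ ≤ (Hᶜ.edgeDensity A B : ℝ)) →
        ∀ π : List (ResLine ℕ), IsResRefutation (cliqueCNF m k fun u v => decide (H.Adj u v)) π → IsPinMonotone π →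
          (m : ℝ) ^ (ε * Real.logb 2 m) ≤ π.length

/-! ## Registered stubs (statements inline, tree vocabulary only) -/

/-- **stub — restriction** (`RestrictRefutation`; LANDED p74232, `Theorems/RamseyUncertifiableResolutionUncertaintyRestrictRefutation.lean`,
stub-worker w-restrict 2026-08-16; ABdRLNR arXiv:2012.09476 Fact 3.2 / Fact 2.1 for this CNF).
Apply `x_{i,e a} ↦ x_{i,a}`, `x_{i,v} ↦ 0` off `range e` (`i < k`), junk variables `w ≥ k·n ↦ k·m + (w - k·n)`:
block axioms ↦ block axioms; functionality / edge axioms inside the range ↦ the corresponding axioms (as `Finset`s;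
`e` need not be monotone); every other axiom contains a satisfied literal and is dropped together with every line
containing a satisfied literal; a resolution step whose pivot is set becomes a weakening of the surviving premise,
one whose pivot survives stays a resolution step (the variable map is injective on surviving variables); `⊥ ↦ ⊥`.
Provable now, size M. -/
theorem stub_restrictRefutation :
    ∀ (n m k : ℕ) (adj : Fin n → Fin n → Bool) (e : Fin m ↪ Fin n) (π : List (ResLine ℕ)),
      IsResRefutation (cliqueCNF n k adj) π →
      ∃ π' : List (ResLine ℕ),
        IsResRefutation (cliqueCNF m k fun a b => adj (e a) (e b)) π' ∧ π'.length ≤ π.length :=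
  Summit.PneNP.PneNP.Theorems.RamseyUncertifiableResolutionUncertainty.stub_restrictRefutation

/-- **stub — DRC step** (`DRCStep`; LANDED p74269, `Theorems/RamseyUncertifiableResolutionUncertaintyDRCStep.lean`, stub-worker w-drc
2026-08-16; finite dependent random choice + Erdős–Szekeres).
Proof plan (constants with slack): `a := ⌈log₂ n / 40⌉`, `h := ⌈log₂ n /(20 κ)⌉`, `δ := min κ (1/4)`.
(1) Average over the `|B|^h` tuples `(b₁,…,b_h) ∈ B^h` of `A₃ := {v ∈ A : ∀ i, ¬ v ~ bᵢ}`: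
`Σ |A₃| = Σ_{v∈A} |B ∖ N(v)|^h ≥ |A|((1-δ)|B|)^h`. (2) Call an `a`-set `Y ⊆ A` BAD if
`|{b ∈ B : ∀ v ∈ Y, ¬ v ~ b}| < |B| n^{-κ}`; `Y ⊆ A₃` for `< (|B| n^{-κ})^h` tuples, and there are `≤ n^a` such `Y`,
so `Σ_tuples #bad(Y ⊆ A₃) ≤ |B|^h n^{a - κh} ≤ |B|^h n^{1 - log₂ n/40}`. (3) Hence some tuple has
`|A₃| - #bad ≥ |A|(1-δ)^h - 1 ≥ n^{1/2 - δ/(10κ)} - 1 ≥ n^{1/3}`; delete one vertex per bad set: `A₄`, no bad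
`a`-subset. (4) Erdős–Szekeres in `A₄` (`exists_clique_or_indep_of_choose_le_card`, `C(k+a-2, a-1) ≤ (66e)^a ≤ n^{1/3}`
for `k = ⌈log₂ n²⌉ ≤ 2log₂ n + 2`): a `k`-clique is excluded, so an independent `a`-set `J ⊆ A₄` exists; it is not
bad. (`B = ∅`: the conclusion only needs `J`, from (4) applied to `A`.) -/
theorem stub_drcStep :
    ∀ κ : ℝ, 0 < κ → ∃ δ : ℝ, 0 < δ ∧ ∃ n₀ : ℕ, ∀ n ≥ n₀, ∀ (H : SimpleGraph (Fin n)) [DecidableRel H.Adj],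
      H.CliqueFree (Nat.clog 2 (n ^ 2)) →
      ∀ A B : Finset (Fin n), (n : ℝ) ^ ((1 : ℝ) / 2) ≤ A.card →
        (∀ v ∈ A, ((B.filter fun b => H.Adj v b).card : ℝ) ≤ δ * B.card) →
        ∃ J ⊆ A, Hᶜ.IsClique (J : Set (Fin n)) ∧ Real.logb 2 n / 40 ≤ J.card ∧
          (B.card : ℝ) * (n : ℝ) ^ (-κ) ≤ ((B.filter fun b => ∀ v ∈ J, ¬ H.Adj v b).card : ℝ) :=
  Summit.PneNP.PneNP.Theorems.RamseyUncertifiableResolutionUncertainty.stub_drcStep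

/-- **stub — Prömel–Rödl core from the DRC step** (`DRCStep → PRCore`; LANDED p74227,
`Theorems/RamseyUncertifiableResolutionUncertaintyPromelRodl.lean`, stub-worker w-pr 2026-08-16).
Proof plan: fix `κ := β := 1/2000`, get `δ₀, n₁` from the hypothesis at `κ`, put `δ := δ₀/2`. Given 2-Ramsey `G` on
`n` vertices run the recursion on states `(T, Jind, Jclq)` — `T ⊆ V`; `Jind` an independent set disjoint from `T` with
no edges to `T`; `Jclq` a clique disjoint from `T` and complete to `T` — from `(univ, ∅, ∅)`: if every disjoint pair
`A, B ⊆ T` with `|A|,|B| ≥ |T|^{1-β}` has `δ ≤ d_G(A,B)` and `δ ≤ d_Ḡ(A,B)`, OUTPUT `S := T`. Otherwise take a bad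
disjoint pair; if `d_G(A,B) < δ`, Markov gives `A₁ ⊆ A`, `|A₁| ≥ |A|/2 ≥ √n`, with `|N(v) ∩ B| ≤ 2δ|B| = δ₀|B|` for
`v ∈ A₁`; the hypothesis (for `H := G`) gives an independent `J ⊆ A₁`, `|J| ≥ log₂ n/40`, and
`T' := {b ∈ B : no edge to J}` with `|T'| ≥ |B| n^{-κ}`; continue with `(T', Jind ∪ J, Jclq)`. If `d_Ḡ(A,B) < δ` do
the same with `H := Gᶜ` (`J` is then a clique of `G`, `T'` its common neighbourhood in `B`; `Jclq ∪ J`). Each level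
adds `≥ log₂ n/40` to `|Jind| + |Jclq| < 2⌈log₂ n²⌉ ≤ 4log₂ n + 4`, so a good `T` appears within `161` levels, where
`|T| ≥ n^{(1-β)^{161} - 161κ} ≥ n^{0.8} ≥ n^{3/4}` (exponent drops by `≤ β + κ` per level). -/
theorem stub_promelRodl :
    (∀ κ : ℝ, 0 < κ → ∃ δ : ℝ, 0 < δ ∧ ∃ n₀ : ℕ, ∀ n ≥ n₀, ∀ (H : SimpleGraph (Fin n)) [DecidableRel H.Adj],
      H.CliqueFree (Nat.clog 2 (n ^ 2)) →
      ∀ A B : Finset (Fin n), (n : ℝ) ^ ((1 : ℝ) / 2) ≤ A.card →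
        (∀ v ∈ A, ((B.filter fun b => H.Adj v b).card : ℝ) ≤ δ * B.card) →
        ∃ J ⊆ A, Hᶜ.IsClique (J : Set (Fin n)) ∧ Real.logb 2 n / 40 ≤ J.card ∧
          (B.card : ℝ) * (n : ℝ) ^ (-κ) ≤ ((B.filter fun b => ∀ v ∈ J, ¬ H.Adj v b).card : ℝ)) →
    ∃ β δ : ℝ, 0 < β ∧ β < 1 ∧ 0 < δ ∧ ∃ n₀ : ℕ, ∀ n ≥ n₀, ∀ (G : SimpleGraph (Fin n)) [DecidableRel G.Adj],
      G.CliqueFree (Nat.clog 2 (n ^ 2)) → Gᶜ.CliqueFree (Nat.clog 2 (n ^ 2)) →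
      ∃ S : Finset (Fin n), (n : ℝ) ^ ((3 : ℝ) / 4) ≤ S.card ∧
        ∀ A ⊆ S, ∀ B ⊆ S, Disjoint A B →
          (S.card : ℝ) ^ (1 - β) ≤ A.card → (S.card : ℝ) ^ (1 - β) ≤ B.card →
          δ ≤ (G.edgeDensity A B : ℝ) ∧ δ ≤ (Gᶜ.edgeDensity A B : ℝ) :=
  Summit.PneNP.PneNP.Theorems.RamseyUncertifiableResolutionUncertainty.stub_promelRodl

/-- **stub — core transfer** (`PRCore → CoreComap`; LANDED p74070,
`Theorems/RamseyUncertifiableResolutionUncertaintyCoreTransfer.lean`, stub-worker w-transfer 2026-08-16): re-index `S` by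
`e := S.orderEmbOfFin rfl : Fin |S| ↪ Fin n`; `edgeDensity (G.comap e) A B = edgeDensity G (A.map e) (B.map e)`
(and the same for the complements, `(G.comap e)ᶜ = Gᶜ.comap e`); `n^{3/4} ≤ |S|` gives `n³ ≤ |S|⁴`. -/
theorem stub_coreTransfer :
    (∃ β δ : ℝ, 0 < β ∧ β < 1 ∧ 0 < δ ∧ ∃ n₀ : ℕ, ∀ n ≥ n₀, ∀ (G : SimpleGraph (Fin n)) [DecidableRel G.Adj],
      G.CliqueFree (Nat.clog 2 (n ^ 2)) → Gᶜ.CliqueFree (Nat.clog 2 (n ^ 2)) →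
      ∃ S : Finset (Fin n), (n : ℝ) ^ ((3 : ℝ) / 4) ≤ S.card ∧
        ∀ A ⊆ S, ∀ B ⊆ S, Disjoint A B →
          (S.card : ℝ) ^ (1 - β) ≤ A.card → (S.card : ℝ) ^ (1 - β) ≤ B.card →
          δ ≤ (G.edgeDensity A B : ℝ) ∧ δ ≤ (Gᶜ.edgeDensity A B : ℝ)) →
    ∃ β δ : ℝ, 0 < β ∧ β < 1 ∧ 0 < δ ∧ ∃ n₀ : ℕ, ∀ n : ℕ, n₀ ≤ n →
      ∀ (G : SimpleGraph (Fin n)) [DecidableRel G.Adj],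
        G.CliqueFree (Nat.clog 2 (n ^ 2)) → Gᶜ.CliqueFree (Nat.clog 2 (n ^ 2)) →
        ∃ (m : ℕ) (e : Fin m ↪ Fin n), n ^ 3 ≤ m ^ 4 ∧
          ∀ A B : Finset (Fin m), Disjoint A B → (m : ℝ) ^ (1 - β) ≤ A.card → (m : ℝ) ^ (1 - β) ≤ B.card →
            δ ≤ ((G.comap e).edgeDensity A B : ℝ) ∧ δ ≤ ((G.comap e)ᶜ.edgeDensity A B : ℝ) :=
  Summit.PneNP.PneNP.Theorems.RamseyUncertifiableResolutionUncertainty.stub_coreTransfer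

/-- **stub — bi-dense core hardness, THE LEVER** (`BiDenseCoreHardness`; conjectural, lead-held). Why plausibly true:
the same bound is a THEOREM for the binary encoding on every graph (LPRT Thm 3, same adversary), for tree-like unary
(LPRT Thm 4) and for regular unary on `G(n,½)` (ABdRLNR Thm 5.1); brute force is tight in shape (cdisprove
`exists_refutation_le_pow_cliqueNum`). Why it might fail: it contains general dag-like resolution for
`Clique(G(m,½), 2log₂m)`, open since BIS07 / BGLR12 / ABdRLNR21 §9. Size XL / open. -/
theorem stub_biDenseCoreHardness :
    ∀ β δ : ℝ, 0 < β → β < 1 → 0 < δ →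
      ∃ ε : ℝ, 0 < ε ∧ ∃ m₀ : ℕ, ∀ m : ℕ, m₀ ≤ m → ∀ k : ℕ, (k : ℝ) ≤ 3 * Real.logb 2 m →
        ∀ (H : SimpleGraph (Fin m)) [DecidableRel H.Adj],
          (∀ A B : Finset (Fin m), Disjoint A B → (m : ℝ) ^ (1 - β) ≤ A.card → (m : ℝ) ^ (1 - β) ≤ B.card →
            δ ≤ (H.edgeDensity A B : ℝ) ∧ δ ≤ (Hᶜ.edgeDensity A B : ℝ)) →
          ∀ π : List (ResLine ℕ), IsResRefutation (cliqueCNF m k fun u v => decide (H.Adj u v)) π →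
            (m : ℝ) ^ (ε * Real.logb 2 m) ≤ π.length := by
  sorry

/-! ## The stubs prove the named statements (definitional read-back) -/

theorem restrictRefutation_of_stub : RestrictRefutation := stub_restrictRefutation
theorem drcStep_of_stub : DRCStep := stub_drcStep
theorem prCore_of_stubs : PRCore := stub_promelRodl stub_drcStep
theorem coreComap_of_stubs : CoreComap := stub_coreTransfer (stub_promelRodl stub_drcStep)
theorem biDenseCoreHardness_of_stub : BiDenseCoreHardness := stub_biDenseCoreHardness

/-! ## Semantics of `cliqueCNF` needed by the composition (proved) -/

/-- Block-variable numbering `(i, v) ↦ i * n + v` (`v < n`) is injective. -/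
theorem blockVar_inj {n i j : ℕ} {u v : Fin n} (h : i * n + (u : ℕ) = j * n + (v : ℕ)) :
    i = j ∧ u = v := by
  have hu := u.isLt
  have hv := v.isLt
  have hij : i = j := by
    rcases lt_trichotomy i j with hlt | heq | hgt
    · exfalso
      have : (i + 1) * n ≤ j * n := Nat.mul_le_mul_right n hlt
      nlinarith
    · exact heq
    · exfalso
      have : (j + 1) * n ≤ i * n := Nat.mul_le_mul_right n hgt
      nlinarith
  subst hij
  exact ⟨rfl, Fin.ext (by omega)⟩

/-- A `k`-clique of the adjacency table (an injective `f : Fin k → Fin n` with `adj (f i) (f j) = true` for `i ≠ j`)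
satisfies `cliqueCNF n k adj`: set `x_{i, f i} := 1` and everything else `0`. -/
theorem satisfiable_cliqueCNF_of_clique {n k : ℕ} (adj : Fin n → Fin n → Bool) (f : Fin k → Fin n)
    (hf : Function.Injective f) (hadj : ∀ i j : Fin k, i ≠ j → adj (f i) (f j) = true) :
    (cliqueCNF n k adj).Satisfiable := by
  classical
  let σ : ℕ → Bool := fun w => decide (∃ i : Fin k, (i : ℕ) * n + (f i : ℕ) = w)
  have hσ : ∀ (i : ℕ) (hi : i < k) (u : Fin n), σ (i * n + (u : ℕ)) = true ↔ f ⟨i, hi⟩ = u := by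
    intro i hi u
    simp only [σ, decide_eq_true_eq]
    constructor
    · rintro ⟨i', hi'⟩
      obtain ⟨h1, h2⟩ := blockVar_inj hi'
      have : i' = ⟨i, hi⟩ := Fin.ext h1
      subst this
      exact h2
    · intro h
      exact ⟨⟨i, hi⟩, by rw [h]⟩
  refine ⟨σ, ?_⟩
  simp only [CNF.eval, List.all_eq_true, List.any_eq_true]
  intro c hc
  simp only [cliqueCNF, List.mem_append] at hc
  rcases hc with (hc | hc) | hc
  · obtain ⟨i, hi, rfl⟩ := List.mem_map.1 hc
    have hi : i < k := List.mem_range.1 hi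
    refine ⟨(i * n + ((f ⟨i, hi⟩ : Fin n) : ℕ), true),
      List.mem_map.2 ⟨((f ⟨i, hi⟩ : Fin n) : ℕ), by simp, rfl⟩, ?_⟩
    have := (hσ i hi (f ⟨i, hi⟩)).2 rfl
    simp [Literal.eval, this]
  · obtain ⟨i, hi, hc⟩ := List.mem_flatMap.1 hc
    have hi : i < k := List.mem_range.1 hi
    obtain ⟨u, hu, hc⟩ := List.mem_flatMap.1 hc
    obtain ⟨v, hv, hc⟩ := List.mem_flatMap.1 hc
    obtain ⟨u, rfl⟩ : ∃ a : Fin n, u = (a : ℕ) := by simpa using hu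
    obtain ⟨v, rfl⟩ : ∃ a : Fin n, v = (a : ℕ) := by simpa using hv
    split_ifs at hc with huv
    · have hc : c = [(i * n + (u : ℕ), false), (i * n + (v : ℕ), false)] := List.mem_singleton.1 hc
      subst hc
      by_cases h1 : σ (i * n + (u : ℕ)) = true
      · have hu : f ⟨i, hi⟩ = u := (hσ i hi u).1 h1
        have h2 : σ (i * n + (v : ℕ)) = false := by
          by_contra h2
          have hv : f ⟨i, hi⟩ = v := (hσ i hi v).1 (by simpa using h2)
          have : (u : ℕ) = v := by rw [← hu, ← hv]
          exact absurd this (ne_of_lt huv)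
        exact ⟨(i * n + (v : ℕ), false), by simp, by simp [Literal.eval, h2]⟩
      · exact ⟨(i * n + (u : ℕ), false), by simp, by simpa [Literal.eval] using h1⟩
    · simp at hc
  · obtain ⟨i, hi, hc⟩ := List.mem_flatMap.1 hc
    have hi : i < k := List.mem_range.1 hi
    obtain ⟨j, hj, hc⟩ := List.mem_flatMap.1 hc
    have hj : j < k := List.mem_range.1 hj
    obtain ⟨u, -, hc⟩ := List.mem_flatMap.1 hc
    obtain ⟨v, -, hc⟩ := List.mem_flatMap.1 hc
    split_ifs at hc with hcond
    · have hc : c = [(i * n + (u : ℕ), false), (j * n + (v : ℕ), false)] := List.mem_singleton.1 hc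
      subst hc
      by_cases h1 : σ (i * n + (u : ℕ)) = true
      · have hu : f ⟨i, hi⟩ = u := (hσ i hi u).1 h1
        have h2 : σ (j * n + (v : ℕ)) = false := by
          by_contra h2
          have hv : f ⟨j, hj⟩ = v := (hσ j hj v).1 (by simpa using h2)
          have hne : (⟨i, hi⟩ : Fin k) ≠ ⟨j, hj⟩ := fun h => hcond.1 (Fin.mk.inj_iff.1 h)
          have := hadj _ _ hne
          rw [hu, hv] at this
          rw [hcond.2] at this
          exact Bool.false_ne_true this
        exact ⟨(j * n + (v : ℕ), false), by simp, by simp [Literal.eval, h2]⟩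
      · exact ⟨(i * n + (u : ℕ), false), by simp, by simpa [Literal.eval] using h1⟩
    · simp at hc

/-- Soundness of resolution for this encoding: if `Clique(G, k)` has a resolution refutation then `G` is `K_k`-free. -/
theorem cliqueFree_of_refutation {n k : ℕ} (G : SimpleGraph (Fin n)) [DecidableRel G.Adj]
    {π : List (ResLine ℕ)} (h : IsResRefutation (cliqueCNF n k fun u v => decide (G.Adj u v)) π) :
    G.CliqueFree k := by
  intro s hs
  have hcard : s.card = k := hs.card_eq
  let f : Fin k → Fin n := fun i => s.orderEmbOfFin hcard i
  have hf_mem : ∀ i, f i ∈ s := fun i => s.orderEmbOfFin_mem hcard i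
  have hf_inj : Function.Injective f := (s.orderEmbOfFin hcard).injective
  refine not_satisfiable_of_isResRefutation_holds h ?_
  refine satisfiable_cliqueCNF_of_clique _ f hf_inj ?_
  intro i j hij
  have hne : f i ≠ f j := fun h => hij (hf_inj h)
  have hadj : G.Adj (f i) (f j) := hs.isClique (hf_mem i) (hf_mem j) hne
  exact decide_eq_true hadj

/-! ## The composition (kernel-checked, no `sorry` of its own) -/

/-- **`ResolutionUncertainty` from core + restriction + lever.** Constants: `β, δ, n₁` from the core; `ε', m₀` from
the lever at `(β, δ)`; `ε := (9/16)·ε'`; `n₀ := max (max n₁ 1) ((max m₀ 256)²)`. For `n ≥ n₀` and any `G`: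
refutations `π₁, π₂` of `Clique(G,k)`, `Clique(Gᶜ,k)` make `G` and `Gᶜ` `K_k`-free (soundness); the core gives
`m⁴ ≥ n³`, `e : Fin m ↪ Fin n`, `BiDense`; `π₁` restricts to `π₁'` over `G.comap e`; `m ≥ max m₀ 256` and
`k = clog₂(n²) ≤ 3·⌊log₂ m⌋ ≤ 3 log₂ m`; the lever gives `m^{ε' log₂ m} ≤ |π₁'| ≤ |π₁|`, and
`n^{ε log₂ n} = 2^{(9/16)ε'(log₂n)²} ≤ 2^{ε'(log₂m)²} = m^{ε' log₂ m}` since `log₂ m ≥ (3/4) log₂ n ≥ 0`. -/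
theorem ResolutionUncertainty_of :
    CoreComap → RestrictRefutation → BiDenseCoreHardness →
      Summit.PneNP.PneNP.Theses.RamseyUncertifiable.ResolutionUncertainty := by
  intro hCore hRes hHard
  rw [crux_unfold]
  obtain ⟨β, δ, hβ0, hβ1, hδ0, n₁, hcore⟩ := hCore
  obtain ⟨ε', hε', m₀, hhard⟩ := hHard β δ hβ0 hβ1 hδ0
  set M₀ : ℕ := max m₀ 256 with hM₀
  refine ⟨9 / 16 * ε', by positivity, max (max n₁ 1) (M₀ ^ 2), ?_⟩
  intro n hn G inst π₁ π₂ h₁ h₂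
  -- bookkeeping on `n`
  have hn₁ : n₁ ≤ n := le_trans (le_trans (le_max_left _ _) (le_max_left _ _)) hn
  have hn1 : 1 ≤ n := le_trans (le_trans (le_max_right _ _) (le_max_left _ _)) hn
  have hnM : M₀ ^ 2 ≤ n := le_trans (le_max_right _ _) hn
  set k : ℕ := Nat.clog 2 (n ^ 2) with hk
  -- both sides are `K_k`-free by soundness, so the core exists
  have hfree : G.CliqueFree k := cliqueFree_of_refutation G h₁
  have hfreeC : Gᶜ.CliqueFree k := cliqueFree_of_refutation Gᶜ h₂
  obtain ⟨m, e, hnm, hdense⟩ := hcore n hn₁ G hfree hfreeC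
  -- restrict `π₁` to the core
  obtain ⟨π₁', h₁', hlen⟩ := hRes n m k (fun u v => decide (G.Adj u v)) e π₁ h₁
  -- `m` is large
  have hmM : M₀ ≤ m := by
    by_contra hlt
    push Not at hlt
    have h4 : m ^ 4 < M₀ ^ 4 := Nat.pow_lt_pow_left hlt (by norm_num)
    have h5 : M₀ ^ 4 ≤ n ^ 2 := by
      calc M₀ ^ 4 = (M₀ ^ 2) ^ 2 := by ring
        _ ≤ n ^ 2 := Nat.pow_le_pow_left hnM 2
    have h6 : n ^ 2 ≤ n ^ 3 := Nat.pow_le_pow_right hn1 (by norm_num)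
    omega
  have hm₀ : m₀ ≤ m := le_trans (le_max_left _ _) hmM
  have hm256 : 256 ≤ m := le_trans (le_max_right _ _) hmM
  have hm1 : 1 ≤ m := le_trans (by norm_num) hm256
  have hmpos : (0 : ℝ) < m := by exact_mod_cast (lt_of_lt_of_le Nat.zero_lt_one hm1)
  have hnpos : (0 : ℝ) < n := by exact_mod_cast (lt_of_lt_of_le Nat.zero_lt_one hn1)
  -- `k ≤ 3 log₂ m`
  set c : ℕ := Nat.log 2 m with hc
  have hc8 : 8 ≤ c := by
    rw [hc]
    exact Nat.le_log_of_pow_le (by norm_num) (by simpa using hm256)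
  have hm_lt : m < 2 ^ (c + 1) := Nat.lt_pow_succ_log_self (by norm_num) m
  have hk3c : k ≤ 3 * c := by
    apply Nat.clog_le_of_le_pow
    have h8 : m ^ 8 < 2 ^ (9 * c) := by
      calc m ^ 8 < (2 ^ (c + 1)) ^ 8 := Nat.pow_lt_pow_left hm_lt (by norm_num)
        _ = 2 ^ (8 * c + 8) := by rw [← pow_mul]; ring_nf
        _ ≤ 2 ^ (9 * c) := Nat.pow_le_pow_right (by norm_num) (by omega)
    have h6 : (n ^ 2) ^ 3 < (2 ^ (3 * c)) ^ 3 := by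
      calc (n ^ 2) ^ 3 = (n ^ 3) ^ 2 := by ring
        _ ≤ (m ^ 4) ^ 2 := Nat.pow_le_pow_left hnm 2
        _ = m ^ 8 := by ring
        _ < 2 ^ (9 * c) := h8
        _ = (2 ^ (3 * c)) ^ 3 := by rw [← pow_mul]; ring_nf
    exact le_of_lt (lt_of_pow_lt_pow_left₀ 3 (Nat.zero_le _) h6)
  have hclog : (c : ℝ) ≤ Real.logb 2 m := by
    rw [Real.le_logb_iff_rpow_le (by norm_num) hmpos, Real.rpow_natCast]
    exact_mod_cast Nat.pow_log_le_self 2 (by omega : m ≠ 0)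
  have hk3 : (k : ℝ) ≤ 3 * Real.logb 2 m := by
    calc (k : ℝ) ≤ ((3 * c : ℕ) : ℝ) := by exact_mod_cast hk3c
      _ = 3 * (c : ℝ) := by push_cast; ring
      _ ≤ 3 * Real.logb 2 m := by linarith
  -- the lever on the core
  have hcoreLB : (m : ℝ) ^ (ε' * Real.logb 2 m) ≤ π₁'.length :=
    hhard m hm₀ k hk3 (G.comap e) hdense π₁' h₁'
  -- compare exponents: `n^{(9/16) ε' log₂ n} ≤ m^{ε' log₂ m}`
  have hx0 : 0 ≤ Real.logb 2 n := Real.logb_nonneg (by norm_num) (by exact_mod_cast hn1)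
  have h34 : 3 * Real.logb 2 n ≤ 4 * Real.logb 2 m := by
    have hcast : ((n : ℝ)) ^ 3 ≤ ((m : ℝ)) ^ 4 := by exact_mod_cast hnm
    have := (Real.logb_le_logb (b := 2) (by norm_num) (by positivity) (by positivity)).2 hcast
    rwa [Real.logb_pow, Real.logb_pow] at this
  have hexp : Real.logb 2 n * (9 / 16 * ε' * Real.logb 2 n) ≤ Real.logb 2 m * (ε' * Real.logb 2 m) := by
    have hA : 0 ≤ 4 * Real.logb 2 m - 3 * Real.logb 2 n := by linarith
    have hB : 0 ≤ 4 * Real.logb 2 m + 3 * Real.logb 2 n := by linarith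
    have hC : 0 ≤ (4 * Real.logb 2 m - 3 * Real.logb 2 n) * (4 * Real.logb 2 m + 3 * Real.logb 2 n) * ε' :=
      mul_nonneg (mul_nonneg hA hB) hε'.le
    nlinarith [hC]
  have hmain : (n : ℝ) ^ (9 / 16 * ε' * Real.logb 2 n) ≤ (m : ℝ) ^ (ε' * Real.logb 2 m) := by
    have hn' : (2 : ℝ) ^ Real.logb 2 n = n := Real.rpow_logb (by norm_num) (by norm_num) hnpos
    have hm' : (2 : ℝ) ^ Real.logb 2 m = m := Real.rpow_logb (by norm_num) (by norm_num) hmpos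
    calc (n : ℝ) ^ (9 / 16 * ε' * Real.logb 2 n)
        = ((2 : ℝ) ^ Real.logb 2 n) ^ (9 / 16 * ε' * Real.logb 2 n) := by rw [hn']
      _ = (2 : ℝ) ^ (Real.logb 2 n * (9 / 16 * ε' * Real.logb 2 n)) := by
          rw [← Real.rpow_mul (by norm_num)]
      _ ≤ (2 : ℝ) ^ (Real.logb 2 m * (ε' * Real.logb 2 m)) :=
          Real.rpow_le_rpow_of_exponent_le (by norm_num) hexp
      _ = ((2 : ℝ) ^ Real.logb 2 m) ^ (ε' * Real.logb 2 m) := by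
          rw [← Real.rpow_mul (by norm_num)]
      _ = (m : ℝ) ^ (ε' * Real.logb 2 m) := by rw [hm']
  -- assemble
  calc (n : ℝ) ^ (9 / 16 * ε' * Real.logb 2 n)
      ≤ (m : ℝ) ^ (ε' * Real.logb 2 m) := hmain
    _ ≤ π₁'.length := hcoreLB
    _ ≤ π₁.length := by exact_mod_cast hlen
    _ ≤ max (π₁.length : ℝ) (π₂.length : ℝ) := le_max_left _ _

/-- **The skeleton.** The crux BY NAME from the five registered stubs (sorries live only in `stub_restrictRefutation`,
`stub_drcStep`, `stub_promelRodl`, `stub_coreTransfer`, `stub_biDenseCoreHardness`). -/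
theorem ResolutionUncertainty_of_stubs :
    Summit.PneNP.PneNP.Theses.RamseyUncertifiable.ResolutionUncertainty :=
  ResolutionUncertainty_of coreComap_of_stubs restrictRefutation_of_stub biDenseCoreHardness_of_stub

end Summit.PneNP.PneNP.Cruxes.ResolutionUncertainty.BoxDagSelfGadgetLifting
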